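import Summits.PneNP.PneNP.Theorems.KarlinRubinMonotoneBlindCoverUpset
import Summits.PneNP.PneNP.Theorems.KarlinRubinMonotoneBlindStubPlantingBound
import Summits.PneNP.PneNP.Theorems.KarlinRubinMonotoneBlindStubCoverBound
import Literature.Computability.Complexity.RossmanMonotoneCliqueThm2Proofs

/-!
# Crux `MonotoneBlind` (stmt-PneNP-18027, route KarlinRubin), line `Sketch`: the dual cover certificate is complete

Line `Sketch` (vertex-cover duality, `Cruxes/MonotoneBlind/Lines/Sketch.lean`) proves the crux from
ONE hard registered stub, `stub_coverCertificate`: for every `δ ∈ (0,1/2)`, every quiet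
polynomial-size `{∧₂, ∨₂, 0, 1}`-family `C` and every `η > 0`, at all but a vanishing fraction of
noises `x ∼ G(n,1/2)` the clique-completion up-set `U(x) = {A | (C n)(x ∪ K_A) = 1}` has a cover `G`
(every member of `U(x)` contains a member of `G`) of cost `∑_{S ∈ G} (d/n)^{|S|} ≤ η`,
`d = ⌈n^{1/2-δ}⌉`. The line card claimed informally (via the Kahn–Kalai conjecture) that this
certificate "loses nothing". This file PROVES it:

* `stub_coverCertificate_iff_strongBlind` — the registered stub statement holds **iff** STRONG
  BLINDNESS holds: every quiet polynomial-size monotone family has planted acceptance `→ 0` at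
  every exponent `δ ∈ (0,1/2)`. Soundness (`strongBlind_of_stub_coverCertificate`) is the landed
  cover bound + planting bound (`stub_coverBound`, `stub_plantingBound`); completeness
  (`stub_coverCertificate_of_strongBlind`) is the Park–Pham theorem
  (`Literature.Combinatorics.SetFamily.parkPham_spreadConst`, the Kahn–Kalai conjecture in
  `p`-biased form) applied at the larger clique `⌈n^{1/2-δ/2}⌉`, whose `n^{δ/2}` gap absorbs the
  `B log n` loss of Park–Pham;
* `coverCertificate_of_plantedAcceptance_tendsto_zero` — the completeness engine for an ARBITRARY
  family of eventually monotone tests (no circuit, size or quietness hypothesis): planted acceptance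
  `→ 0` at exponent `δ'` forces `η`-cheap `(⌈n^{1/2-δ}⌉/n)`-covers at typical noise for every
  `δ > δ'`; so every strong-blindness theorem for a class of tests (e.g. the landed DNF / CNF /
  local-OR theorems of `KarlinRubinMonotoneBlind{DnfBlind,Cnf,LocalOrBlind}.lean`) yields the
  certificate for that class;
* `monotoneBlind_of_strongBlind` — strong blindness implies the crux (the composition of the line);
* tools: `density_powersetCard_mono_of_upset` (uniform `j`-set densities of an up-set increase with
  `j`, double counting), `sum_biasedWeight_upset_le` (`μ_p(U) ≤ k`-density `+ Pr_p[|W| > k]`),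
  `sum_biasedWeight_mul_card` / `mul_sum_biasedWeight_card_gt_le` (mean size and Markov tail of
  `μ_p`), `exists_cover_cost_lt_one_of_biased_le_half` (Park–Pham contrapositive),
  `exists_cheap_cover_of_kSet_le` (the deterministic core at one `n`), `eventually_scale`
  (`log n · n^{1/2-δ} = o(n^{1/2-δ'})`), `erdosRenyiHalf_markov`.

Consequence for the crux: the hard stub is neither weaker nor stronger than the natural strong form
of `MonotoneBlind`; the line's value is the LANGUAGE (per-noise finite certificates that compose
along `∨`/`∧` of the given circuit), not a reduction in strength.

All `--supports stmt-PneNP-18027`; no definitions.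

References: J. Park, H. T. Pham, J. Amer. Math. Soc. 37 (2024), Thm. 1.1 [ParkPham2024];
T. Bell, Electron. J. Combin. 30(2) (2023), Thm. 3 [Bell2023]; M. Talagrand, STOC 2010
[Talagrand2010]; J. Kahn, G. Kalai, Combin. Probab. Comput. 16 (2007) (the conjecture).
-/

set_option linter.dupNamespace false -- `Summit.PneNP.PneNP.…` is the layout-mandated namespace

namespace Summit.PneNP.PneNP.Theorems.MonotoneBlind.VertexCover

open Literature.Computability.Complexity Literature.Probability.RandomGraphs.PlantedClique Filter Finset
open Literature.Combinatorics.SetFamily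
open scoped ENNReal Topology Classical

/-! ### Markov over the noise -/

/-- **Markov's inequality under `G(n,1/2)`** for an `ℝ≥0∞`-valued statistic. [folklore] -/
theorem erdosRenyiHalf_markov {n : ℕ} (g : EdgeVec n → ℝ≥0∞) {a : ℝ≥0∞} (ha : a ≠ 0) (ha' : a ≠ ⊤) :
    (erdosRenyiHalf n).toOuterMeasure {x | a < g x} ≤ a⁻¹ * ∑' x, erdosRenyiHalf n x * g x := by
  rw [PMF.toOuterMeasure_apply, ← ENNReal.tsum_mul_left]
  refine ENNReal.tsum_le_tsum fun x => ?_
  by_cases hx : x ∈ {x | a < g x}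
  · rw [Set.indicator_of_mem hx]
    have hle : a ≤ g x := le_of_lt hx
    calc erdosRenyiHalf n x = a⁻¹ * (a * erdosRenyiHalf n x) := by
          rw [← mul_assoc, ENNReal.inv_mul_cancel ha ha', one_mul]
      _ ≤ a⁻¹ * (g x * erdosRenyiHalf n x) := by gcongr
      _ = a⁻¹ * (erdosRenyiHalf n x * g x) := by rw [mul_comm (g x)]
  · rw [Set.indicator_of_notMem hx]
    exact bot_le


/-! ### Asymptotics of the scales -/

/-- **The two clique scales separate by more than the Park–Pham loss**: for
`0 < δ' < δ < 1/2` and `η > 0`, eventually `5 B log(2n) · ⌈n^{1/2-δ}⌉ ≤ η · ⌈n^{1/2-δ'}⌉`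
(`log n · n^{1/2-δ} = o(n^{1/2-δ'})`). [folklore] -/
theorem eventually_scale {δ' δ : ℝ} (hδ'δ : δ' < δ) (hδ : δ < 1 / 2) {η : ℝ} (hη : 0 < η) :
    ∀ᶠ n : ℕ in atTop, 5 * spreadConst * Real.log ((n : ℕ) / (1 / 2 : ℝ)) * ⌈(n : ℝ) ^ (1 / 2 - δ)⌉₊ ≤
      η * ⌈(n : ℝ) ^ (1 / 2 - δ')⌉₊ := by
  have hB := spreadConst_pos
  set a : ℝ := 1 / 2 - δ with ha
  set b : ℝ := 1 / 2 - δ' with hb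
  have ha0 : 0 < a := by rw [ha]; linarith
  have hγ : 0 < b - a := by rw [ha, hb]; linarith
  -- `log n / n^{b-a} → 0`
  have h1 : Tendsto (fun n : ℕ => Real.log (n : ℝ) / (n : ℝ) ^ (b - a)) atTop (𝓝 0) :=
    ((isLittleO_log_rpow_atTop hγ).comp_tendsto tendsto_natCast_atTop_atTop).tendsto_div_nhds_zero
  have hc : 0 < η / (40 * spreadConst) := by positivity
  have h2 : ∀ᶠ n : ℕ in atTop, Real.log (n : ℝ) / (n : ℝ) ^ (b - a) ≤ η / (40 * spreadConst) :=
    (h1.eventually (ge_mem_nhds hc)).mono fun _ h => h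
  filter_upwards [h2, eventually_ge_atTop 2] with n h2 hn2
  have hnr : (2 : ℝ) ≤ n := by exact_mod_cast hn2
  have hn0 : (0 : ℝ) < n := by linarith
  have hna : 1 ≤ (n : ℝ) ^ a := Real.one_le_rpow (by linarith) ha0.le
  have hnγ : 0 < (n : ℝ) ^ (b - a) := Real.rpow_pos_of_pos hn0 _
  -- `log(2n) ≤ 2 log n`
  have hlog2 : Real.log 2 ≤ Real.log (n : ℝ) := Real.log_le_log two_pos hnr
  have hL : Real.log ((n : ℕ) / (1 / 2 : ℝ)) ≤ 2 * Real.log (n : ℝ) := by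
    have : ((n : ℕ) : ℝ) / (1 / 2 : ℝ) = 2 * n := by ring
    rw [this, Real.log_mul two_ne_zero hn0.ne']
    linarith
  have hLnn : 0 ≤ Real.log (n : ℝ) := Real.log_nonneg (by linarith)
  -- `⌈n^a⌉ ≤ 2 n^a`, `n^b ≤ ⌈n^b⌉`
  have hceil_a : (⌈(n : ℝ) ^ a⌉₊ : ℝ) ≤ 2 * (n : ℝ) ^ a := by
    have := (Nat.ceil_lt_add_one (Real.rpow_nonneg hn0.le a)).le
    linarith
  have hceil_b : (n : ℝ) ^ b ≤ (⌈(n : ℝ) ^ b⌉₊ : ℝ) := Nat.le_ceil _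
  -- `log n ≤ (η / 40B) n^{b-a}`
  have hlog : Real.log (n : ℝ) ≤ η / (40 * spreadConst) * (n : ℝ) ^ (b - a) := by
    rwa [div_le_iff₀ hnγ] at h2
  have hsplit : (n : ℝ) ^ (b - a) * (n : ℝ) ^ a = (n : ℝ) ^ b := by
    rw [← Real.rpow_add hn0]; ring_nf
  calc 5 * spreadConst * Real.log ((n : ℕ) / (1 / 2 : ℝ)) * ⌈(n : ℝ) ^ a⌉₊
      ≤ 5 * spreadConst * (2 * Real.log (n : ℝ)) * (2 * (n : ℝ) ^ a) := by
        apply mul_le_mul (mul_le_mul_of_nonneg_left hL (by positivity)) hceil_a (by positivity)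
        positivity
    _ = 20 * spreadConst * Real.log (n : ℝ) * (n : ℝ) ^ a := by ring
    _ ≤ 20 * spreadConst * (η / (40 * spreadConst) * (n : ℝ) ^ (b - a)) * (n : ℝ) ^ a := by
        apply mul_le_mul_of_nonneg_right _ (by positivity)
        exact mul_le_mul_of_nonneg_left hlog (by positivity)
    _ = η / 2 * ((n : ℝ) ^ (b - a) * (n : ℝ) ^ a) := by field_simp; ring
    _ = η / 2 * (n : ℝ) ^ b := by rw [hsplit]
    _ ≤ η * (n : ℝ) ^ b := by
        have : 0 ≤ (n : ℝ) ^ b := Real.rpow_nonneg hn0.le b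
        nlinarith
    _ ≤ η * ⌈(n : ℝ) ^ b⌉₊ := mul_le_mul_of_nonneg_left hceil_b hη.le

/-- The planted clique scale `⌈n^{1/2-δ'}⌉` is eventually in `[1, n]`. [folklore] -/
theorem eventually_kScale_mem {δ' : ℝ} (hδ'0 : 0 < δ') :
    ∀ᶠ n : ℕ in atTop, 1 ≤ ⌈(n : ℝ) ^ (1 / 2 - δ')⌉₊ ∧ ⌈(n : ℝ) ^ (1 / 2 - δ')⌉₊ ≤ n := by
  filter_upwards [eventually_ge_atTop 1] with n hn
  have hnr : (1 : ℝ) ≤ n := by exact_mod_cast hn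
  constructor
  · refine Nat.one_le_iff_ne_zero.2 fun h => ?_
    have := Nat.ceil_eq_zero.1 h
    have hpos : 0 < (n : ℝ) ^ (1 / 2 - δ') := Real.rpow_pos_of_pos (by linarith) _
    linarith
  · refine Nat.ceil_le.2 ?_
    calc (n : ℝ) ^ (1 / 2 - δ') ≤ (n : ℝ) ^ (1 : ℝ) :=
          Real.rpow_le_rpow_of_exponent_le hnr (by linarith)
      _ = n := Real.rpow_one _

/-! ### Completeness: vanishing planted acceptance forces cheap covers -/

/-- **Completeness of the dual cover certificate** (the converse direction of line `Sketch`).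
Let `f n` be tests on the edges of `Kₙ`, monotone for all large `n`, and `0 < δ' < δ < 1/2`. If the
planted acceptance at the LARGER clique `⌈n^{1/2-δ'}⌉` tends to `0`, then for every `η > 0` the
`G(n,1/2)`-probability that the clique-completion up-set `{A | f n (plant A x) = 1}` has NO cover
of `(d/n)`-cost `≤ η`, `d = min ⌈n^{1/2-δ}⌉ n`, tends to `0`. Proof: Markov over the noise bounds
the probability that the uniform-`⌈n^{1/2-δ'}⌉`-set measure of the up-set exceeds `1/4` by four
times the planted acceptance; at every other noise the core lemma (`exists_cheap_cover_of_kSet_le`: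
up-set measure comparison + Park–Pham + rescaling, the `log n` loss absorbed by `n^{δ-δ'}`)
produces the cover. [folklore] -/
theorem coverCertificate_of_plantedAcceptance_tendsto_zero (f : (n : ℕ) → EdgeVec n → Bool)
    (hf : ∀ᶠ n : ℕ in atTop, Monotone (f n)) {δ' δ : ℝ} (hδ'0 : 0 < δ') (hδ'δ : δ' < δ)
    (hδ : δ < 1 / 2)
    (hP : Tendsto (fun n : ℕ => (plantedCliqueDist n ⌈(n : ℝ) ^ (1 / 2 - δ')⌉₊).toOuterMeasure
      {y | f n y = true}) atTop (𝓝 0)) (η : ℝ≥0∞) (hη : 0 < η) :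
    Tendsto (fun n : ℕ => (erdosRenyiHalf n).toOuterMeasure
      {x | ¬ ∃ G : Finset (Finset (Fin n)),
        (∀ A : Finset (Fin n), f n (plant A x) = true → ∃ S ∈ G, S ⊆ A) ∧
          ∑ S ∈ G, ((((min ⌈(n : ℝ) ^ (1 / 2 - δ)⌉₊ n : ℕ) : ℝ≥0∞) / (n : ℝ≥0∞)) ^ S.card) ≤ η})
      atTop (𝓝 0) := by
  by_cases hη1 : 1 ≤ η
  · -- the trivial cover `{∅}` has cost `1 ≤ η`: the bad set is empty
    have hempty : ∀ n : ℕ, {x : EdgeVec n | ¬ ∃ G : Finset (Finset (Fin n)),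
        (∀ A : Finset (Fin n), f n (plant A x) = true → ∃ S ∈ G, S ⊆ A) ∧
          ∑ S ∈ G, ((((min ⌈(n : ℝ) ^ (1 / 2 - δ)⌉₊ n : ℕ) : ℝ≥0∞) / (n : ℝ≥0∞)) ^ S.card) ≤ η} = ∅ := by
      intro n
      ext x
      simp only [Set.mem_setOf_eq, Set.mem_empty_iff_false, iff_false, not_not]
      refine ⟨{∅}, fun A _ => ⟨∅, mem_singleton_self _, empty_subset _⟩, ?_⟩
      simpa using hη1
    simp only [hempty, MeasureTheory.measure_empty]
    exact tendsto_const_nhds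
  -- `η < 1`: work with the real budget `ηr = η.toReal ∈ (0, 1)`
  push Not at hη1
  have hηtop : η ≠ ⊤ := (hη1.trans ENNReal.one_lt_top).ne
  have hη0 : η ≠ 0 := hη.ne'
  set ηr : ℝ := η.toReal with hηr
  have hηr0 : 0 < ηr := ENNReal.toReal_pos hη0 hηtop
  have hηr1 : ηr ≤ 1 := by
    have := (ENNReal.toReal_le_toReal hηtop ENNReal.one_ne_top).2 hη1.le
    simpa using this
  -- eventual facts
  have hev := (hf.and ((eventually_kScale_mem hδ'0).and
    ((eventually_scale hδ'δ hδ hηr0).and (eventually_ge_atTop 1))))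
  -- the bound `Pr[bad] ≤ 4 · planted acceptance`, eventually
  have hbound : ∀ᶠ n : ℕ in atTop, (erdosRenyiHalf n).toOuterMeasure
      {x | ¬ ∃ G : Finset (Finset (Fin n)),
        (∀ A : Finset (Fin n), f n (plant A x) = true → ∃ S ∈ G, S ⊆ A) ∧
          ∑ S ∈ G, ((((min ⌈(n : ℝ) ^ (1 / 2 - δ)⌉₊ n : ℕ) : ℝ≥0∞) / (n : ℝ≥0∞)) ^ S.card) ≤ η} ≤
      4 * (plantedCliqueDist n ⌈(n : ℝ) ^ (1 / 2 - δ')⌉₊).toOuterMeasure {y | f n y = true} := by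
    filter_upwards [hev] with n hn
    obtain ⟨hmono, ⟨hk1, hkn⟩, hscale, hn1⟩ := hn
    set k' : ℕ := ⌈(n : ℝ) ^ (1 / 2 - δ')⌉₊ with hk'
    set D : ℕ := min ⌈(n : ℝ) ^ (1 / 2 - δ)⌉₊ n with hD
    set μ : EdgeVec n → ℝ≥0∞ := fun x =>
      (PMF.uniformOfFinset (kSubsets n k') (kSubsets_nonempty n k')).toOuterMeasure
        {A | f n (plant A x) = true} with hμ
    -- (i) bad noises have `k'`-measure `> 1/4`
    have hsub : {x | ¬ ∃ G : Finset (Finset (Fin n)),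
        (∀ A : Finset (Fin n), f n (plant A x) = true → ∃ S ∈ G, S ⊆ A) ∧
          ∑ S ∈ G, (((D : ℕ) : ℝ≥0∞) / (n : ℝ≥0∞)) ^ S.card ≤ η} ⊆ {x | 4⁻¹ < μ x} := by
      intro x hx
      simp only [Set.mem_setOf_eq] at hx ⊢
      by_contra hle
      push Not at hle
      apply hx
      have hU : ∀ S T : Finset (Fin n), S ⊆ T → S ∈ {A | f n (plant A x) = true} →
          T ∈ {A | f n (plant A x) = true} := by
        intro S T hST hS
        simp only [Set.mem_setOf_eq] at hS ⊢
        have h := hmono (plant_mono_set hST x)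
        rw [hS] at h
        exact top_le_iff.1 h
      have hscaleD : 5 * spreadConst * Real.log ((n : ℕ) / (1 / 2 : ℝ)) * D ≤ ηr * k' := by
        refine le_trans ?_ hscale
        apply mul_le_mul_of_nonneg_left _ _
        · exact_mod_cast min_le_left _ _
        · have hB := spreadConst_pos
          have hL : 0 ≤ Real.log ((n : ℕ) / (1 / 2 : ℝ)) := by
            apply Real.log_nonneg
            rw [le_div_iff₀ (by norm_num : (0 : ℝ) < 1 / 2)]
            have : (1 : ℝ) ≤ n := by exact_mod_cast hn1
            linarith
          positivity
      obtain ⟨G, hGcov, hGcost⟩ := exists_cheap_cover_of_kSet_le hn1 {A | f n (plant A x) = true} hU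
        hk1 hkn hηr0 hηr1 hscaleD hle
      refine ⟨G, fun A hA => hGcov A hA, ?_⟩
      rw [coverCost_ennreal_eq_ofReal hn1 D G]
      calc ENNReal.ofReal (∑ S ∈ G, ((D : ℝ) / n) ^ #S) ≤ ENNReal.ofReal ηr := ENNReal.ofReal_le_ofReal hGcost
        _ = η := ENNReal.ofReal_toReal hηtop
    -- (ii) Markov and the planting identity
    calc (erdosRenyiHalf n).toOuterMeasure _ ≤ (erdosRenyiHalf n).toOuterMeasure {x | 4⁻¹ < μ x} :=
          (erdosRenyiHalf n).toOuterMeasure.mono hsub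
      _ ≤ (4⁻¹ : ℝ≥0∞)⁻¹ * ∑' x, erdosRenyiHalf n x * μ x :=
          erdosRenyiHalf_markov μ (by simp) (by simp)
      _ = 4 * (plantedCliqueDist n k').toOuterMeasure {y | f n y = true} := by
          rw [inv_inv, plantedCliqueDist_toOuterMeasure_eq_tsum]
          rfl
  -- squeeze
  have hlim : Tendsto (fun n : ℕ => 4 * (plantedCliqueDist n ⌈(n : ℝ) ^ (1 / 2 - δ')⌉₊).toOuterMeasure
      {y | f n y = true}) atTop (𝓝 0) := by
    have h4 : (4 : ℝ≥0∞) ≠ ⊤ := ENNReal.ofNat_ne_top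
    have := ENNReal.Tendsto.const_mul hP (Or.inr h4)
    simpa using this
  exact tendsto_of_tendsto_of_tendsto_of_le_of_le' tendsto_const_nhds hlim
    (Eventually.of_forall fun _ => bot_le) hbound


/-! ### The registered stub is equivalent to strong blindness -/

/-- **Strong blindness implies the dual certificate** (`stub_coverCertificate` of line `Sketch`
from strong blindness at every exponent): apply
`coverCertificate_of_plantedAcceptance_tendsto_zero` to the family `(C n).eval` at `δ' = δ/2`.
[folklore] -/
theorem stub_coverCertificate_of_strongBlind
    (hSB : ∀ δ : ℝ, 0 < δ → δ < 1 / 2 → ∀ c : ℕ, ∀ C : (n : ℕ) → Circuit ((⊤ : SimpleGraph (Fin n)).edgeSet),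
      (∀ᶠ n : ℕ in atTop, (C n).IsOver monotoneBasis01 ∧ (C n).size ≤ n ^ c) →
      Tendsto (fun n : ℕ => (erdosRenyiHalf n).toOuterMeasure {x | (C n).eval x = true}) atTop (𝓝 0) →
      Tendsto (fun n : ℕ => (plantedCliqueDist n ⌈(n : ℝ) ^ (1 / 2 - δ)⌉₊).toOuterMeasure
        {x | (C n).eval x = true}) atTop (𝓝 0)) :
    ∀ δ : ℝ, 0 < δ → δ < 1 / 2 → ∀ c : ℕ, ∀ C : (n : ℕ) → Circuit ((⊤ : SimpleGraph (Fin n)).edgeSet),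
      (∀ᶠ n : ℕ in atTop, (C n).IsOver monotoneBasis01 ∧ (C n).size ≤ n ^ c) →
      Tendsto (fun n : ℕ => (erdosRenyiHalf n).toOuterMeasure {x | (C n).eval x = true}) atTop (𝓝 0) →
      ∀ η : ℝ≥0∞, 0 < η →
        Tendsto (fun n : ℕ => (erdosRenyiHalf n).toOuterMeasure
          {x | ¬ ∃ G : Finset (Finset (Fin n)),
            (∀ A : Finset (Fin n), (C n).eval (plant A x) = true → ∃ S ∈ G, S ⊆ A) ∧
              ∑ S ∈ G, ((((min ⌈(n : ℝ) ^ (1 / 2 - δ)⌉₊ n : ℕ) : ℝ≥0∞) / (n : ℝ≥0∞)) ^ S.card) ≤ η})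
          atTop (𝓝 0) := by
  intro δ hδ hδ' c C hC hnull η hη
  have hmono : ∀ᶠ n : ℕ in atTop, Monotone (C n).eval :=
    hC.mono fun n hn => (C n).monotone_eval_of_isOver_monotoneBasis01 hn.1
  have hP := hSB (δ / 2) (by linarith) (by linarith) c C hC hnull
  exact coverCertificate_of_plantedAcceptance_tendsto_zero (fun n => (C n).eval) hmono
    (by linarith) (by linarith) hδ' hP η hη

/-- **The dual certificate implies strong blindness** (soundness, the direction the skeleton
`Lines/Sketch.lean` uses): off the bad-noise set the cover bound (`stub_coverBound`) caps the
`k`-set measure of the up-set by `η`, and the planting bound (`stub_plantingBound`) gives planted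
acceptance `≤ η + Pr[bad] ≤ 2η` eventually. [folklore] -/
theorem strongBlind_of_stub_coverCertificate
    (hCC : ∀ δ : ℝ, 0 < δ → δ < 1 / 2 → ∀ c : ℕ, ∀ C : (n : ℕ) → Circuit ((⊤ : SimpleGraph (Fin n)).edgeSet),
      (∀ᶠ n : ℕ in atTop, (C n).IsOver monotoneBasis01 ∧ (C n).size ≤ n ^ c) →
      Tendsto (fun n : ℕ => (erdosRenyiHalf n).toOuterMeasure {x | (C n).eval x = true}) atTop (𝓝 0) →
      ∀ η : ℝ≥0∞, 0 < η →
        Tendsto (fun n : ℕ => (erdosRenyiHalf n).toOuterMeasure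
          {x | ¬ ∃ G : Finset (Finset (Fin n)),
            (∀ A : Finset (Fin n), (C n).eval (plant A x) = true → ∃ S ∈ G, S ⊆ A) ∧
              ∑ S ∈ G, ((((min ⌈(n : ℝ) ^ (1 / 2 - δ)⌉₊ n : ℕ) : ℝ≥0∞) / (n : ℝ≥0∞)) ^ S.card) ≤ η})
          atTop (𝓝 0)) :
    ∀ δ : ℝ, 0 < δ → δ < 1 / 2 → ∀ c : ℕ, ∀ C : (n : ℕ) → Circuit ((⊤ : SimpleGraph (Fin n)).edgeSet),
      (∀ᶠ n : ℕ in atTop, (C n).IsOver monotoneBasis01 ∧ (C n).size ≤ n ^ c) →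
      Tendsto (fun n : ℕ => (erdosRenyiHalf n).toOuterMeasure {x | (C n).eval x = true}) atTop (𝓝 0) →
      Tendsto (fun n : ℕ => (plantedCliqueDist n ⌈(n : ℝ) ^ (1 / 2 - δ)⌉₊).toOuterMeasure
        {x | (C n).eval x = true}) atTop (𝓝 0) := by
  intro δ hδ hδ' c C hC hnull
  rw [ENNReal.tendsto_atTop_zero]
  intro ε hε
  have hε2 : 0 < ε / 2 := by simpa using hε.ne'
  have hcert := hCC δ hδ hδ' c C hC hnull (ε / 2) hε2
  rw [ENNReal.tendsto_atTop_zero] at hcert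
  obtain ⟨N, hN⟩ := hcert (ε / 2) hε2
  refine ⟨N, fun n hn => ?_⟩
  set k : ℕ := ⌈(n : ℝ) ^ (1 / 2 - δ)⌉₊ with hk
  set B : Set (EdgeVec n) := {x | ¬ ∃ G : Finset (Finset (Fin n)),
    (∀ A : Finset (Fin n), (C n).eval (plant A x) = true → ∃ S ∈ G, S ⊆ A) ∧
      ∑ S ∈ G, ((((min k n : ℕ) : ℝ≥0∞) / (n : ℝ≥0∞)) ^ S.card) ≤ ε / 2} with hB
  have hgood : ∀ x, x ∉ B →
      (PMF.uniformOfFinset (kSubsets n k) (kSubsets_nonempty n k)).toOuterMeasure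
        {A | (C n).eval (plant A x) = true} ≤ ε / 2 := by
    intro x hx
    simp only [hB, Set.mem_setOf_eq, not_not] at hx
    obtain ⟨G, hG, hcost⟩ := hx
    exact (stub_coverBound n k {A | (C n).eval (plant A x) = true} G (fun A hA => hG A hA)).trans hcost
  calc (plantedCliqueDist n k).toOuterMeasure {x | (C n).eval x = true}
      ≤ ε / 2 + (erdosRenyiHalf n).toOuterMeasure B := stub_plantingBound n k (C n).eval (ε / 2) B hgood
    _ ≤ ε / 2 + ε / 2 := add_le_add le_rfl (hN n hn)
    _ = ε := ENNReal.add_halves ε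

/-- **The hard stub of line `Sketch` is EXACTLY strong blindness.** The registered statement of
`stub_coverCertificate` (dual cover certificate at every exponent) holds if and only if every
quiet polynomial-size `{∧₂, ∨₂, 0, 1}`-family has vanishing planted acceptance at every exponent
`δ ∈ (0, 1/2)` — the strong form of the crux `MonotoneBlind`. (Park–Pham supplies completeness,
the cover and planting bounds soundness.) [folklore] -/
theorem stub_coverCertificate_iff_strongBlind :
    (∀ δ : ℝ, 0 < δ → δ < 1 / 2 → ∀ c : ℕ, ∀ C : (n : ℕ) → Circuit ((⊤ : SimpleGraph (Fin n)).edgeSet),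
      (∀ᶠ n : ℕ in atTop, (C n).IsOver monotoneBasis01 ∧ (C n).size ≤ n ^ c) →
      Tendsto (fun n : ℕ => (erdosRenyiHalf n).toOuterMeasure {x | (C n).eval x = true}) atTop (𝓝 0) →
      ∀ η : ℝ≥0∞, 0 < η →
        Tendsto (fun n : ℕ => (erdosRenyiHalf n).toOuterMeasure
          {x | ¬ ∃ G : Finset (Finset (Fin n)),
            (∀ A : Finset (Fin n), (C n).eval (plant A x) = true → ∃ S ∈ G, S ⊆ A) ∧
              ∑ S ∈ G, ((((min ⌈(n : ℝ) ^ (1 / 2 - δ)⌉₊ n : ℕ) : ℝ≥0∞) / (n : ℝ≥0∞)) ^ S.card) ≤ η})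
          atTop (𝓝 0)) ↔
    (∀ δ : ℝ, 0 < δ → δ < 1 / 2 → ∀ c : ℕ, ∀ C : (n : ℕ) → Circuit ((⊤ : SimpleGraph (Fin n)).edgeSet),
      (∀ᶠ n : ℕ in atTop, (C n).IsOver monotoneBasis01 ∧ (C n).size ≤ n ^ c) →
      Tendsto (fun n : ℕ => (erdosRenyiHalf n).toOuterMeasure {x | (C n).eval x = true}) atTop (𝓝 0) →
      Tendsto (fun n : ℕ => (plantedCliqueDist n ⌈(n : ℝ) ^ (1 / 2 - δ)⌉₊).toOuterMeasure
        {x | (C n).eval x = true}) atTop (𝓝 0)) :=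
  ⟨strongBlind_of_stub_coverCertificate, stub_coverCertificate_of_strongBlind⟩

/-- **Strong blindness suffices for the crux.** If every quiet polynomial-size monotone family has
vanishing planted acceptance at every exponent, then `MonotoneBlind` holds: an error sum `→ 0`
forces null acceptance `→ 0`, hence planted acceptance `→ 0`, while planted rejection `→ 0` too —
impossible since acceptance and rejection sum to `1` (`stub_acceptanceSplit` is re-derived inline
to keep this file's imports minimal). [folklore] -/
theorem monotoneBlind_of_strongBlind
    (hSB : ∀ δ : ℝ, 0 < δ → δ < 1 / 2 → ∀ c : ℕ, ∀ C : (n : ℕ) → Circuit ((⊤ : SimpleGraph (Fin n)).edgeSet),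
      (∀ᶠ n : ℕ in atTop, (C n).IsOver monotoneBasis01 ∧ (C n).size ≤ n ^ c) →
      Tendsto (fun n : ℕ => (erdosRenyiHalf n).toOuterMeasure {x | (C n).eval x = true}) atTop (𝓝 0) →
      Tendsto (fun n : ℕ => (plantedCliqueDist n ⌈(n : ℝ) ^ (1 / 2 - δ)⌉₊).toOuterMeasure
        {x | (C n).eval x = true}) atTop (𝓝 0)) :
    Summit.PneNP.PneNP.Theses.KarlinRubin.MonotoneBlind := by
  intro δ hδ hδ' c hyp
  obtain ⟨C, hC, hT⟩ := hyp
  have hnull : Tendsto (fun n : ℕ => (erdosRenyiHalf n).toOuterMeasure {x | (C n).eval x = true})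
      atTop (𝓝 0) :=
    tendsto_of_tendsto_of_tendsto_of_le_of_le' tendsto_const_nhds hT
      (Eventually.of_forall fun _ => bot_le) (Eventually.of_forall fun _ => le_self_add)
  have hrej : Tendsto (fun n : ℕ =>
      (plantedCliqueDist n ⌈(n : ℝ) ^ (1 / 2 - δ)⌉₊).toOuterMeasure {x | (C n).eval x = false})
      atTop (𝓝 0) :=
    tendsto_of_tendsto_of_tendsto_of_le_of_le' tendsto_const_nhds hT
      (Eventually.of_forall fun _ => bot_le) (Eventually.of_forall fun _ => le_add_self)
  have hacc := hSB δ hδ hδ' c C hC hnull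
  have hsum := hacc.add hrej
  rw [zero_add] at hsum
  -- but acceptance + rejection = 1 for every `n`
  have hone : ∀ n : ℕ, (plantedCliqueDist n ⌈(n : ℝ) ^ (1 / 2 - δ)⌉₊).toOuterMeasure {x | (C n).eval x = true}
      + (plantedCliqueDist n ⌈(n : ℝ) ^ (1 / 2 - δ)⌉₊).toOuterMeasure {x | (C n).eval x = false} = 1 := by
    intro n
    set P := plantedCliqueDist n ⌈(n : ℝ) ^ (1 / 2 - δ)⌉₊
    rw [PMF.toOuterMeasure_apply, PMF.toOuterMeasure_apply, ← ENNReal.tsum_add, ← P.tsum_coe]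
    refine tsum_congr fun y => ?_
    cases h : (C n).eval y <;> simp [Set.indicator, h]
  simp only [hone] at hsum
  have := tendsto_nhds_unique hsum tendsto_const_nhds
  exact one_ne_zero this.symm

end Summit.PneNP.PneNP.Theorems.MonotoneBlind.VertexCover
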